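import Mathlib
import Summits.Ventures.FusionMHD.Models.CerfonFreidbergIterLikeQ25Facts
import Literature.MathematicalPhysics.MHD.CerfonFreidbergContDiff
import Summits.Ventures.FusionMHD.Models.CerfonFreidbergIterLikeQHalfSurface
import HarnessLib

/-!
# Ventures/FusionMHD — Models/CerfonFreidbergIterLikeQ25Surface.lean: the surface `ψ_N = 1/4` of THE Cerfon–Freidberg ITER-like flux AS A
# CERTIFIED CLOSED CURVE, and the identification of the certified `CFIterLike.Q25.qHalfOverF` (= `q(1/4)/F`) with Freidberg's `(6.35)` loop
# integral `GradShafranov.safetyFactorE` (`ψ_N = 1/4` SIBLING of `Models/CerfonFreidbergIterLikeQHalfSurface.lean`, companion of ★ #117)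

HONEST FRAMING (LADDER-GRIDFUSION three columns; CF rung, F2 item R2; companion of «F2.CF-Q-QUARTER-ITER»).  The assembly file
`Models/CerfonFreidbergIterLikeQ25.lean` brackets the polar `(6.35)` integral of the surface `U = 3U(X_a,0)/4` to `±7·10⁻⁸`.  THIS FILE closes the
reading exactly as the `ψ_N = 1/2` companion does:
* **`safetyFactorE_loop_eq`**: for every `F`, `GradShafranov.safetyFactorE F U (PolarRay.loop X_a 0 ρ) (2π) = F · qHalfOverF` — Freidberg's
  `q = (F/2π)∮ dl/(R²B_p)` over the polar loop of the surface IS the certified number times `F` (model-7's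
  `FluxSurfacePolarRayLoop.safetyFactorE_eq_polar_rayRadius`; hypotheses from `…Q25Facts.surface_facts` / `continuousOn_ρ`, `hasFDerivAt_cfSolution`,
  `radialDeriv_eq_of_hasDerivAt` + the `ψ_N = 1/2` Ray file's `hasDerivAt_rayProfile`; `LU` BY NAME);
* **`safetyFactorE_loop_bounds`**: `2.148000327·F ≤ q(ψ_N = 1/4) ≤ 2.148000798·F` for `F ≥ 0`.
MODELLED: analytic Cerfon–Freidberg family (ITER-like triple); `q` of a MODEL surface — nothing about a device or stability.
Typer/prover: gridfusion-model-5 (g8), 2026-08-27.  Citations: Freidberg 2014 §6.3.5 (6.35) [Freidberg2014].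
-/

noncomputable section

open Set MeasureTheory intervalIntegral
open Literature.Analysis.ValidatedNumerics Literature.Analysis.ValidatedNumerics.PolyMP Literature.Analysis.ValidatedNumerics.ExpPoly
open Literature.MathematicalPhysics.MHD Literature.MathematicalPhysics.MHD.CerfonFreidberg Literature.MathematicalPhysics.MHD.GradShafranov
open Summit.Ventures.FusionMHD.Models.PolarRay

set_option autoImplicit false

namespace Summit.Ventures.FusionMHD.Models.CFIterLike.Q25

/-! ## §2 Freidberg's `(6.35)` loop integral over the surface equals `F · qHalfOverF` -/

/-- At a loop point: `U` is Fréchet-differentiable and its radial derivative is `CFIterLike.QHalf.Dfield θ (ρ θ)`; `R > 0`. -/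
theorem loop_point_facts {θ : ℝ} (hθ : θ ∈ Icc 0 (2 * Real.pi)) :
    HasFDerivAt (fun q : ℝ × ℝ => CFIterLike.U q.1 q.2) (CFIterLike.QHalf.LU (loop Xa 0 ρ θ)) (loop Xa 0 ρ θ)
    ∧ radialDeriv (CFIterLike.QHalf.LU (loop Xa 0 ρ θ) (1, 0)) (CFIterLike.QHalf.LU (loop Xa 0 ρ θ) (0, 1)) θ = CFIterLike.QHalf.Dfield θ (ρ θ)
    ∧ 0 < (loop Xa 0 ρ θ).1 := by
  obtain ⟨-, hρ0, hρ1, -⟩ := surface_facts hθ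
  have hX : 0 < Xa + ρ θ * Real.cos θ := CFIterLike.QHalf.X_pos_of_box hρ0.le hρ1 ⟨le_rfl, le_rfl⟩
  have hfd : HasFDerivAt (fun q : ℝ × ℝ => U q.1 q.2) (CFIterLike.QHalf.LU (loop Xa 0 ρ θ)) (loop Xa 0 ρ θ) := by
    have h := hasFDerivAt_cfSolution 0 coeff (X := Xa + ρ θ * Real.cos θ) (Y := 0 + ρ θ * Real.sin θ) hX.ne'
    exact h
  refine ⟨hfd, ?_, hX⟩
  have hψ : HasFDerivAt (fun q : ℝ × ℝ => U q.1 q.2) (CFIterLike.QHalf.LU (loop Xa 0 ρ θ)) (rayPoint Xa 0 θ (ρ θ)) := hfd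
  exact radialDeriv_eq_of_hasDerivAt hψ (CFIterLike.QHalf.hasDerivAt_rayProfile hX)

/-- **FREIDBERG'S `(6.35)` `q` OF THE SURFACE `ψ_N = 1/4` IS `F · qHalfOverF`.**  For the glued polar loop `γ(θ) = (X_a + ρ(θ) cos θ, ρ(θ) sin θ)`
of the level set `U = 3U(X_a,0)/4` (star-shaped about the axis, `ρ` continuous, first crossing of every ray):
`safetyFactorE F U γ (2π) = F · qHalfOverF`. -/
theorem safetyFactorE_loop_eq (F : ℝ) : safetyFactorE F CFIterLike.U (loop Xa 0 ρ) (2 * Real.pi) = F * qHalfOverF := by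
  have h2pi : (0 : ℝ) ≤ 2 * Real.pi := by positivity
  have huI : uIcc (0 : ℝ) (2 * Real.pi) = Icc 0 (2 * Real.pi) := uIcc_of_le h2pi
  have hmain : safetyFactorE F U (loop Xa 0 ρ) (2 * Real.pi) = F / (2 * Real.pi) * ∫ θ in (0 : ℝ)..(2 * Real.pi), Pq θ := by
    rw [show loop Xa 0 ρ = loop Xa 0 (rayRadius U Xa 0 u₀) from rfl]
    rw [safetyFactorE_eq_polar_rayRadius (ψ := U) (Rc := Xa) (Zc := 0) (u := u₀) (F := F) (L := fun θ => CFIterLike.QHalf.LU (loop Xa 0 ρ θ))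
      (fun θ hθ => (surface_facts hθ).1) continuousOn_ρ
      (fun θ hθ => by rw [huI] at hθ; exact (surface_facts hθ).2.1)
      (fun θ hθ => by rw [huI] at hθ; exact (loop_point_facts hθ).1)
      (fun θ hθ => by
        rw [huI] at hθ
        show radialDeriv (CFIterLike.QHalf.LU (loop Xa 0 ρ θ) (1, 0)) (CFIterLike.QHalf.LU (loop Xa 0 ρ θ) (0, 1)) θ ≠ 0
        rw [(loop_point_facts hθ).2.1]; exact (surface_facts hθ).2.2.2.ne')
      (fun θ hθ => by rw [huI] at hθ; exact (loop_point_facts hθ).2.2)]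
    congr 1
    apply intervalIntegral.integral_congr
    intro θ hθ
    rw [huI] at hθ
    show rayRadius U Xa 0 u₀ θ / ((loop Xa 0 ρ θ).1 * |radialDeriv (CFIterLike.QHalf.LU (loop Xa 0 ρ θ) (1, 0)) (CFIterLike.QHalf.LU (loop Xa 0 ρ θ) (0, 1)) θ|) = Pq θ
    rw [(loop_point_facts hθ).2.1, abs_of_pos (surface_facts hθ).2.2.2]
    rfl
  rw [hmain, qHalfOverF]
  ring

/-- **COROLLARY (`ψ_N = 1/4`): `2.148000327·F ≤ q(ψ_N = 1/2) ≤ 2.148000798·F`** for `F ≥ 0`, `q` = Freidberg's `(6.35)` loop integral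
over the surface `ψ_N = 1/4`. -/
theorem safetyFactorE_loop_bounds {F : ℝ} (hF : 0 ≤ F) :
    ((2148000327 / 1000000000) : ℝ) * F ≤ safetyFactorE F CFIterLike.U (loop Xa 0 ρ) (2 * Real.pi)
    ∧ safetyFactorE F U (loop Xa 0 ρ) (2 * Real.pi) ≤ ((1074000399 / 500000000) : ℝ) * F := by
  rw [safetyFactorE_loop_eq]
  obtain ⟨h1, h2⟩ := qHalfOverF_bounds
  constructor <;> nlinarith

end Summit.Ventures.FusionMHD.Models.CFIterLike.Q25

end
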